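import Summits.AtomisticToContinuum.BoseEinsteinCondensation.Theorems.BECInsertionCorrectorCorrectorClosureNearMinimiserRigidityFrame
import Literature.MathematicalPhysics.QuantumManyBody.PeriodicGroundStateFeynmanKacProofs
import Literature.MathematicalPhysics.QuantumManyBody.PeriodizedPotentialNearestImage
import Literature.MathematicalPhysics.QuantumManyBody.PeriodicConfigFourier
import Literature.MathematicalPhysics.QuantumManyBody.CondensateOccupationStability
import Literature.MathematicalPhysics.QuantumManyBody.WeightedCorrector
import Literature.MathematicalPhysics.QuantumManyBody.BoseGasThermodynamicLimitRuelle
import HarnessLib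

/-!
# Crux `GridInfDivCoherence` (stmt-AtomisticToContinuum-9114), line `registered`, lead cycle 3:
# positivity of the translation coherence of near-minimisers — BOUNDED potentials

Route `BECInfDivCoherence`, sub-problem `BoseEinsteinCondensation`. The crux `GridInfDivCoherence` is the
conjunction of

* **(P)** every `δ`-near-minimiser `Ψ` of the periodic `N`-body energy on the torus of side
  `L = (N/ρ)^{1/3}` has strictly positive translation coherence
  `G_Ψ(i, r) = Re ∫_{cell^N} conj Ψ(…, xᵢ + r, …) Ψ(X) dX > 0` for every particle `i` and every `r ∈ ℝ³`
  (for all large `N`, some `δ(N) > 0`), and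
* **(Sign)** the non-trivial discrete Lévy weights of `log G_Ψ` on the `η`-grid are `≥ −ε`.

(P) is a fixed-`N` statement of Perron–Frobenius type. This file PROVES it for every repulsive
finite-range potential that is BOUNDED (`v ≤ C`; registered stub `stub_coherencePos_bounded` of the
line), from the torus Feynman–Kac package already in the tree:

* `PeriodicGroundStateFeynmanKac_holds` (`PeriodicGroundStateFeynmanKacProofs.lean`): for bounded
  `v^per` the torus Hamiltonian has a unique cell-normalised ground state `Ψ₀`, continuous and strictly
  positive (`IsPeriodicGroundStateFK`);
* `rigidity_of_nearMinimiser` (`Theorems/…CorrectorClosureNearMinimiserRigidityFrame.lean`, crux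
  stmt-12058): for every `η > 0` some `δ > 0` makes every `δ`-near-minimiser `η`-close in `L²(cell)` to
  `αΨ₀`, `1 - η ≤ |α|² ≤ 1`.

The new estimate is the **`L²`-stability of the translation coherence**
(`abs_re_coh_sub_re_coh_le`): for continuous periodic `a, b`,
`|G_a(r) - G_b(r)| ≤ ‖a - b‖ (‖a‖ + ‖b‖)` (cell `L²` norms; Cauchy–Schwarz and shift invariance of the
cell integral), and the **floor of the ground-state coherence** `G_{Ψ₀}(r) ≥ m₀/M` where
`m₀ ≤ Ψ₀ ≤ M` (`setIntegral_translate_mul_ge`). With `η = min(1/2, (g/8)²)`, `g = m₀/M`, every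
`δ`-near-minimiser has `G_Ψ(i, r) ≥ (1-η)g - 2√η ≥ g/4 > 0` for all `i`, `r`
(`stub_coherencePos_bounded`; in fact a UNIFORM-in-`r` floor at fixed `N`).

What is NOT here: unbounded / hard-core `v` (the Feynman–Kac package of the tree is stated for bounded
`v^per`; registered stub `stub_coherencePos_unbounded`), and the sign conjunct (open physics,
`stub_gridLevySign`).

References: Reed–Simon IV Thm XIII.44 [ReedSimonIV1978]; Glimm–Jaffe §3.3 [GlimmJaffeQP1987];
LSSY (2005) §1.2 [LSSY2005].
-/

noncomputable section

namespace Summit.AtomisticToContinuum.BoseEinsteinCondensation.Theorems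

open MeasureTheory Filter Literature.MathematicalPhysics.QuantumManyBody.BoseGas
open scoped ENNReal NNReal ComplexConjugate

namespace CoherencePos

variable {N : ℕ} {L : ℝ}

/-! ### Cauchy–Schwarz on the cell -/

/-- A continuous function is in `L²` of the (bounded) cell. [folklore] -/
theorem memLp_two_cellN_of_continuous (L : ℝ) {f : Config N → ℂ} (hf : Continuous f) :
    MemLp f 2 (volume.restrict (cellN N L)) := by
  rw [memLp_two_iff_integrable_sq_norm hf.aestronglyMeasurable]
  exact integrableOn_cellN (hf.norm.pow 2) L

/-- **Cauchy–Schwarz on the cell**: `‖∫_{cell^N} conj f · g‖ ≤ √(∫‖f‖²) √(∫‖g‖²)` for continuous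
`f, g`. [folklore] -/
theorem norm_setIntegral_conj_mul_le (L : ℝ) {f g : Config N → ℂ} (hf : Continuous f)
    (hg : Continuous g) :
    ‖∫ X in cellN N L, conj (f X) * g X‖ ≤
      Real.sqrt (∫ X in cellN N L, ‖f X‖ ^ 2) * Real.sqrt (∫ X in cellN N L, ‖g X‖ ^ 2) := by
  have hf2 : MemLp f (ENNReal.ofReal 2) (volume.restrict (cellN N L)) := by
    rw [ENNReal.ofReal_ofNat]; exact memLp_two_cellN_of_continuous L hf
  have hg2 : MemLp g (ENNReal.ofReal 2) (volume.restrict (cellN N L)) := by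
    rw [ENNReal.ofReal_ofNat]; exact memLp_two_cellN_of_continuous L hg
  have hH := integral_mul_norm_le_Lp_mul_Lq Real.HolderConjugate.two_two hf2 hg2
  calc ‖∫ X in cellN N L, conj (f X) * g X‖
      ≤ ∫ X in cellN N L, ‖conj (f X) * g X‖ := norm_integral_le_integral_norm _
    _ = ∫ X in cellN N L, ‖f X‖ * ‖g X‖ := by
        refine integral_congr_ae (ae_of_all _ fun X => ?_)
        simp only [norm_mul, RCLike.norm_conj]
    _ ≤ (∫ X in cellN N L, ‖f X‖ ^ (2 : ℝ)) ^ (1 / (2 : ℝ)) *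
          (∫ X in cellN N L, ‖g X‖ ^ (2 : ℝ)) ^ (1 / (2 : ℝ)) := hH
    _ = Real.sqrt (∫ X in cellN N L, ‖f X‖ ^ 2) * Real.sqrt (∫ X in cellN N L, ‖g X‖ ^ 2) := by
        simp only [Real.rpow_two, Real.sqrt_eq_rpow]

/-! ### Shift invariance of cell `L²` norms of periodic functions -/

/-- `∫_{cell^N} ‖F(X + C)‖² = ∫_{cell^N} ‖F‖²` for `F` periodic in every particle. [folklore] -/
theorem setIntegral_norm_sq_comp_add (hL : 0 < L) {F : Config N → ℂ}
    (hper : ∀ (X : Config N) (i : Fin N) (k : Fin 3),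
      F (X + Pi.single i (EuclideanSpace.single k L)) = F X)
    (C : Config N) :
    ∫ X in cellN N L, ‖F (X + C)‖ ^ 2 = ∫ X in cellN N L, ‖F X‖ ^ 2 :=
  setIntegral_cellN_comp_add hL (G := fun X => ‖F X‖ ^ 2) (fun X i k => by simp only [hper]) C

/-! ### `L²`-stability of the translation coherence -/

/-- **`L²`-stability of the translation coherence.** For continuous functions `a, b` on `(ℝ³)^N`,
periodic in every particle, and any translation `C` of configuration space,
`|Re ∫ conj a(X+C) a(X) − Re ∫ conj b(X+C) b(X)| ≤ √(∫‖a−b‖²) (√(∫‖a‖²) + √(∫‖b‖²))`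
(all integrals over the cell): write the difference as `∫ conj (a−b)(X+C) a(X) + ∫ conj b(X+C) (a−b)(X)`,
Cauchy–Schwarz, and shift invariance of the cell norms. [folklore] -/
theorem abs_re_coh_sub_re_coh_le (hL : 0 < L) {a b : Config N → ℂ} (ha : Continuous a)
    (hb : Continuous b)
    (haper : ∀ (X : Config N) (i : Fin N) (k : Fin 3),
      a (X + Pi.single i (EuclideanSpace.single k L)) = a X)
    (hbper : ∀ (X : Config N) (i : Fin N) (k : Fin 3),
      b (X + Pi.single i (EuclideanSpace.single k L)) = b X)
    (C : Config N) :
    |(∫ X in cellN N L, conj (a (X + C)) * a X).re - (∫ X in cellN N L, conj (b (X + C)) * b X).re| ≤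
      Real.sqrt (∫ X in cellN N L, ‖a X - b X‖ ^ 2) *
        (Real.sqrt (∫ X in cellN N L, ‖a X‖ ^ 2) + Real.sqrt (∫ X in cellN N L, ‖b X‖ ^ 2)) := by
  have haC : Continuous fun X : Config N => a (X + C) := ha.comp (continuous_add_const C)
  have hbC : Continuous fun X : Config N => b (X + C) := hb.comp (continuous_add_const C)
  have hdC : Continuous fun X : Config N => a (X + C) - b (X + C) := haC.sub hbC
  have hd : Continuous fun X : Config N => a X - b X := ha.sub hb
  have hi1 : Integrable (fun X => conj (a (X + C)) * a X) (volume.restrict (cellN N L)) :=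
    integrableOn_cellN ((Complex.continuous_conj.comp haC).mul ha) L
  have hi2 : Integrable (fun X => conj (b (X + C)) * b X) (volume.restrict (cellN N L)) :=
    integrableOn_cellN ((Complex.continuous_conj.comp hbC).mul hb) L
  have hi3 : Integrable (fun X => conj (a (X + C) - b (X + C)) * a X) (volume.restrict (cellN N L)) :=
    integrableOn_cellN ((Complex.continuous_conj.comp hdC).mul ha) L
  have hi4 : Integrable (fun X => conj (b (X + C)) * (a X - b X)) (volume.restrict (cellN N L)) :=
    integrableOn_cellN ((Complex.continuous_conj.comp hbC).mul hd) L
  -- the algebraic splitting of the difference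
  have hsplit : (∫ X in cellN N L, conj (a (X + C)) * a X) - (∫ X in cellN N L, conj (b (X + C)) * b X) =
      (∫ X in cellN N L, conj (a (X + C) - b (X + C)) * a X) +
        ∫ X in cellN N L, conj (b (X + C)) * (a X - b X) := by
    rw [← integral_sub hi1 hi2, ← integral_add hi3 hi4]
    refine integral_congr_ae (ae_of_all _ fun X => ?_)
    simp only [map_sub]
    ring
  -- Cauchy–Schwarz on both pieces, with shift invariance of the translated norms
  have hdper : ∀ (X : Config N) (i : Fin N) (k : Fin 3),
      (a (X + Pi.single i (EuclideanSpace.single k L)) - b (X + Pi.single i (EuclideanSpace.single k L)))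
        = a X - b X := fun X i k => by rw [haper, hbper]
  have h1 : ‖∫ X in cellN N L, conj (a (X + C) - b (X + C)) * a X‖ ≤
      Real.sqrt (∫ X in cellN N L, ‖a X - b X‖ ^ 2) * Real.sqrt (∫ X in cellN N L, ‖a X‖ ^ 2) := by
    have h := norm_setIntegral_conj_mul_le L hdC ha
    rwa [setIntegral_norm_sq_comp_add hL (F := fun X => a X - b X) hdper C] at h
  have h2 : ‖∫ X in cellN N L, conj (b (X + C)) * (a X - b X)‖ ≤
      Real.sqrt (∫ X in cellN N L, ‖b X‖ ^ 2) * Real.sqrt (∫ X in cellN N L, ‖a X - b X‖ ^ 2) := by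
    have h := norm_setIntegral_conj_mul_le L hbC hd
    rwa [setIntegral_norm_sq_comp_add hL hbper C] at h
  calc |(∫ X in cellN N L, conj (a (X + C)) * a X).re - (∫ X in cellN N L, conj (b (X + C)) * b X).re|
      = |((∫ X in cellN N L, conj (a (X + C)) * a X) -
            (∫ X in cellN N L, conj (b (X + C)) * b X)).re| := by rw [Complex.sub_re]
    _ ≤ ‖(∫ X in cellN N L, conj (a (X + C)) * a X) - (∫ X in cellN N L, conj (b (X + C)) * b X)‖ :=
        Complex.abs_re_le_norm _
    _ = ‖(∫ X in cellN N L, conj (a (X + C) - b (X + C)) * a X) +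
          ∫ X in cellN N L, conj (b (X + C)) * (a X - b X)‖ := by rw [hsplit]
    _ ≤ ‖∫ X in cellN N L, conj (a (X + C) - b (X + C)) * a X‖ +
          ‖∫ X in cellN N L, conj (b (X + C)) * (a X - b X)‖ := norm_add_le _ _
    _ ≤ _ := by
        have := add_le_add h1 h2
        linarith [this]

/-! ### The ground state: bounds and the floor of its coherence -/

/-- A continuous, strictly positive function that is periodic in every particle is bounded ABOVE and
BELOW by positive constants: `m₀ ≤ Ψ₀ ≤ M`, `0 < m₀`. (Upper bound: compactness of the closed cell;
lower bound: the same for the continuous periodic function `1/Ψ₀`.) [folklore] -/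
theorem exists_pos_bounds_of_continuous_periodic_pos (hL : 0 < L) {Ψ₀ : Config N → ℝ}
    (hcont : Continuous Ψ₀) (hpos : ∀ X, 0 < Ψ₀ X)
    (hper : ∀ (X : Config N) (i : Fin N) (k : Fin 3),
      Ψ₀ (X + Pi.single i (EuclideanSpace.single k L)) = Ψ₀ X) :
    ∃ m₀ M : ℝ, 0 < m₀ ∧ m₀ ≤ M ∧ (∀ X, m₀ ≤ Ψ₀ X) ∧ ∀ X, Ψ₀ X ≤ M := by
  obtain ⟨M, -, hM⟩ := exists_bound_of_continuous_periodic hL hcont hper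
  have hinv : Continuous fun X => (Ψ₀ X)⁻¹ := hcont.inv₀ fun X => (hpos X).ne'
  obtain ⟨M', hM'0, hM'⟩ := exists_bound_of_continuous_periodic hL hinv
    (fun X i k => by simp only [hper])
  have hX0 : ∀ X, (M' + 1)⁻¹ ≤ Ψ₀ X := fun X => by
    have h1 : (Ψ₀ X)⁻¹ ≤ M' + 1 := ((le_abs_self _).trans (hM' X)).trans (by linarith)
    have h2 : 0 < (Ψ₀ X)⁻¹ := inv_pos.2 (hpos X)
    calc (M' + 1)⁻¹ ≤ ((Ψ₀ X)⁻¹)⁻¹ := inv_anti₀ h2 h1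
      _ = Ψ₀ X := inv_inv _
  classical
  have hN0 : ∀ X, Ψ₀ X ≤ M := fun X => (le_abs_self _).trans (hM X)
  refine ⟨(M' + 1)⁻¹, M, by positivity, ?_, hX0, hN0⟩
  exact (hX0 0).trans (hN0 0)

/-- **Floor of the ground-state coherence.** If `m₀ ≤ Ψ₀ ≤ M` with `0 < m₀` and `∫_{cell}Ψ₀² = 1`,
then for every translation `C`, `∫_{cell} Ψ₀(X + C) Ψ₀(X) dX ≥ m₀/M`
(`Ψ₀(X+C) ≥ m₀ ≥ (m₀/M) Ψ₀(X)`). [folklore] -/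
theorem setIntegral_translate_mul_ge (L : ℝ) {Ψ₀ : Config N → ℝ} (hcont : Continuous Ψ₀)
    {m₀ M : ℝ} (hm₀ : 0 < m₀) (hmM : m₀ ≤ M) (hlo : ∀ X, m₀ ≤ Ψ₀ X) (hhi : ∀ X, Ψ₀ X ≤ M)
    (hnorm : ∫ X in cellN N L, Ψ₀ X ^ 2 = 1) (C : Config N) :
    m₀ / M ≤ ∫ X in cellN N L, Ψ₀ (X + C) * Ψ₀ X := by
  have hM : 0 < M := hm₀.trans_le hmM
  have hpt : ∀ X, m₀ / M * Ψ₀ X ^ 2 ≤ Ψ₀ (X + C) * Ψ₀ X := fun X => by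
    have h0 : 0 ≤ Ψ₀ X := hm₀.le.trans (hlo X)
    have h1 : m₀ / M * Ψ₀ X ≤ m₀ := by
      rw [div_mul_eq_mul_div, div_le_iff₀ hM]
      exact mul_le_mul_of_nonneg_left (hhi X) hm₀.le
    calc m₀ / M * Ψ₀ X ^ 2 = (m₀ / M * Ψ₀ X) * Ψ₀ X := by ring
      _ ≤ m₀ * Ψ₀ X := mul_le_mul_of_nonneg_right h1 h0
      _ ≤ Ψ₀ (X + C) * Ψ₀ X := mul_le_mul_of_nonneg_right (hlo _) h0
  have hi1 : Integrable (fun X => m₀ / M * Ψ₀ X ^ 2) (volume.restrict (cellN N L)) :=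
    (integrableOn_cellN (hcont.pow 2) L).const_mul _
  have hi2 : Integrable (fun X => Ψ₀ (X + C) * Ψ₀ X) (volume.restrict (cellN N L)) :=
    integrableOn_cellN ((hcont.comp (continuous_add_const C)).mul hcont) L
  calc m₀ / M = ∫ X in cellN N L, m₀ / M * Ψ₀ X ^ 2 := by rw [integral_const_mul, hnorm, mul_one]
    _ ≤ ∫ X in cellN N L, Ψ₀ (X + C) * Ψ₀ X := integral_mono hi1 hi2 hpt

/-- `∫_{cell} Ψ₀² = 1` in real Bochner form, from the `ℝ≥0∞` normalisation of a continuous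
nonnegative `Ψ₀`. [folklore] -/
theorem setIntegral_sq_eq_one_of_lintegral (L : ℝ) {Ψ₀ : Config N → ℝ} (hcont : Continuous Ψ₀)
    (hnn : ∀ X, 0 ≤ Ψ₀ X) (h : ∫⁻ X in cellN N L, ENNReal.ofReal (Ψ₀ X) ^ 2 = 1) :
    ∫ X in cellN N L, Ψ₀ X ^ 2 = 1 := by
  have hc : Continuous fun X => Ψ₀ X ^ 2 := hcont.pow 2
  have h1 : ∫⁻ X in cellN N L, ENNReal.ofReal (Ψ₀ X ^ 2) = 1 := by
    rw [← h]
    refine lintegral_congr fun X => ?_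
    rw [ENNReal.ofReal_pow (hnn X)]
  have h2 := ofReal_integral_eq_lintegral_ofReal (integrableOn_cellN hc L)
    (ae_of_all _ fun X => sq_nonneg (Ψ₀ X))
  rw [h1] at h2
  have h3 : 0 ≤ ∫ X in cellN N L, Ψ₀ X ^ 2 := integral_nonneg fun X => sq_nonneg _
  have := congrArg ENNReal.toReal h2
  rwa [ENNReal.toReal_ofReal h3, ENNReal.toReal_one] at this

/-! ### From rigidity to positivity of the coherence of near-minimisers -/

/-- `∫_{cell}‖Ψ − αΨ₀‖² ≤ η` in real form, from the `ℝ≥0∞` bound. [folklore] -/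
theorem setIntegral_norm_sub_sq_le_of_lintegral (L : ℝ) {F : Config N → ℂ} (hF : Continuous F)
    {η : ℝ} (hη : 0 ≤ η) (h : ∫⁻ X in cellN N L, (‖F X‖₊ : ℝ≥0∞) ^ 2 ≤ ENNReal.ofReal η) :
    ∫ X in cellN N L, ‖F X‖ ^ 2 ≤ η := by
  rw [lintegral_cellN_nnnorm_sq_eq_ofReal L hF] at h
  exact (ENNReal.ofReal_le_ofReal_iff hη).1 h

/-- **Positivity of the coherence near the ray of the ground state** (the deterministic core).
Let `Ψ₀` be continuous, periodic, with `m₀ ≤ Ψ₀ ≤ M`, `0 < m₀`, `∫Ψ₀² = 1`, put `g = m₀/M`, and let `a`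
be a continuous periodic complex function with `∫‖a‖² = 1` which is `η`-close to `αΨ₀` in `L²(cell)`
with `‖α‖ ≤ 1`, `1 − η ≤ ‖α‖²`, where `η ≤ 1/2` and `√η ≤ g/8`. Then for every translation `C`,
`Re ∫_{cell} conj a(X + C) a(X) dX ≥ g/4 > 0`. [folklore] -/
theorem re_coh_pos_of_close {Ψ₀ : Config N → ℝ} (hL : 0 < L) (hcont : Continuous Ψ₀)
    (hper : ∀ (X : Config N) (i : Fin N) (k : Fin 3),
      Ψ₀ (X + Pi.single i (EuclideanSpace.single k L)) = Ψ₀ X)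
    {m₀ M : ℝ} (hm₀ : 0 < m₀) (hmM : m₀ ≤ M) (hlo : ∀ X, m₀ ≤ Ψ₀ X) (hhi : ∀ X, Ψ₀ X ≤ M)
    (hnorm : ∫ X in cellN N L, Ψ₀ X ^ 2 = 1)
    {a : Config N → ℂ} (ha : Continuous a)
    (haper : ∀ (X : Config N) (i : Fin N) (k : Fin 3),
      a (X + Pi.single i (EuclideanSpace.single k L)) = a X)
    (hanorm : ∫ X in cellN N L, ‖a X‖ ^ 2 = 1)
    {η : ℝ} (hη2 : η ≤ 1 / 2) (hηg : Real.sqrt η ≤ m₀ / M / 8)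
    {α : ℂ} (hα1 : ‖α‖ ≤ 1) (hα2 : 1 - η ≤ ‖α‖ ^ 2)
    (hclose : ∫ X in cellN N L, ‖a X - α * (Ψ₀ X : ℂ)‖ ^ 2 ≤ η) (C : Config N) :
    m₀ / M / 4 ≤ (∫ X in cellN N L, conj (a (X + C)) * a X).re := by
  set g : ℝ := m₀ / M with hg
  have hM : 0 < M := hm₀.trans_le hmM
  have hg0 : 0 < g := div_pos hm₀ hM
  -- the comparison function `b = α Ψ₀`
  set b : Config N → ℂ := fun X => α * (Ψ₀ X : ℂ) with hb
  have hbc : Continuous b := continuous_const.mul (Complex.continuous_ofReal.comp hcont)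
  have hbper : ∀ (X : Config N) (i : Fin N) (k : Fin 3),
      b (X + Pi.single i (EuclideanSpace.single k L)) = b X := fun X i k => by
    simp only [hb, hper]
  -- its coherence is `|α|² ∫ Ψ₀(X+C) Ψ₀(X) ≥ (1-η) g`
  have hbcoh : (∫ X in cellN N L, conj (b (X + C)) * b X).re =
      ‖α‖ ^ 2 * ∫ X in cellN N L, Ψ₀ (X + C) * Ψ₀ X := by
    have h1 : ∀ X, conj (b (X + C)) * b X = ((‖α‖ ^ 2 * (Ψ₀ (X + C) * Ψ₀ X) : ℝ) : ℂ) := by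
      intro X
      simp only [hb, map_mul, Complex.conj_ofReal]
      rw [show conj α * (Ψ₀ (X + C) : ℂ) * (α * (Ψ₀ X : ℂ)) = (conj α * α) * ((Ψ₀ (X + C) : ℂ) * Ψ₀ X)
        by ring, Complex.conj_mul' α]
      push_cast
      ring
    simp_rw [h1]
    rw [integral_complex_ofReal, Complex.ofReal_re, integral_const_mul]
  have hbnorm : ∫ X in cellN N L, ‖b X‖ ^ 2 = ‖α‖ ^ 2 := by
    have h1 : ∀ X, ‖b X‖ ^ 2 = ‖α‖ ^ 2 * Ψ₀ X ^ 2 := fun X => by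
      simp only [hb, norm_mul, Complex.norm_real, Real.norm_eq_abs, mul_pow, sq_abs]
    simp_rw [h1]
    rw [integral_const_mul, hnorm, mul_one]
  have hfloor : g ≤ ∫ X in cellN N L, Ψ₀ (X + C) * Ψ₀ X :=
    setIntegral_translate_mul_ge L hcont hm₀ hmM hlo hhi hnorm C
  -- stability
  have hstab := abs_re_coh_sub_re_coh_le hL ha hbc haper hbper C
  rw [hanorm, hbnorm, Real.sqrt_one] at hstab
  have hsqα : Real.sqrt (‖α‖ ^ 2) = ‖α‖ := Real.sqrt_sq (norm_nonneg α)
  rw [hsqα] at hstab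
  have hD : Real.sqrt (∫ X in cellN N L, ‖a X - b X‖ ^ 2) ≤ Real.sqrt η := Real.sqrt_le_sqrt hclose
  have hcoh1 : Real.sqrt (∫ X in cellN N L, ‖a X - b X‖ ^ 2) * (1 + ‖α‖) ≤ 2 * Real.sqrt η := by
    calc Real.sqrt (∫ X in cellN N L, ‖a X - b X‖ ^ 2) * (1 + ‖α‖)
        ≤ Real.sqrt η * (1 + 1) := by
          apply mul_le_mul hD (by linarith) (by positivity) (Real.sqrt_nonneg _)
      _ = 2 * Real.sqrt η := by ring
  have hlow : (1 - η) * g ≤ (∫ X in cellN N L, conj (b (X + C)) * b X).re := by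
    rw [hbcoh]
    calc (1 - η) * g ≤ ‖α‖ ^ 2 * g := mul_le_mul_of_nonneg_right hα2 hg0.le
      _ ≤ ‖α‖ ^ 2 * ∫ X in cellN N L, Ψ₀ (X + C) * Ψ₀ X :=
          mul_le_mul_of_nonneg_left hfloor (sq_nonneg _)
  have habs := (abs_sub_le_iff.1 hstab).2
  -- arithmetic: (1-η) g - 2√η ≥ g/2 - g/4
  have h4 : 2 * Real.sqrt η ≤ g / 4 := by rw [hg]; linarith
  nlinarith [hlow, habs, hcoh1, h4, hg0]

end CoherencePos

open CoherencePos

/-- **Registered stub `stub_coherencePos_bounded` of line `registered` (crux `GridInfDivCoherence`,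
stmt-AtomisticToContinuum-9114): positivity of the translation coherence of near-minimisers, BOUNDED
potentials.** For every repulsive finite-range pair potential `v` that is bounded (`v ≤ C`) there is
`ρ₀ > 0` (any density works; `ρ₀ = 1`) such that for `0 < ρ < ρ₀` and all large `N` some `δ > 0` makes
EVERY `δ`-near-minimiser `Ψ` of the periodic `N`-body energy on the torus of side `L = (N/ρ)^{1/3}`
have strictly positive translation coherence: `Re ∫_{cell^N} conj Ψ(…, xᵢ + r, …) Ψ(X) dX > 0` for
every particle `i` and every `r ∈ ℝ³`. Proof: for `N ≥ 1` and `2R₀ < L` the periodised potential is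
bounded (nearest image), so the torus Hamiltonian has a continuous strictly positive Feynman–Kac ground
state `Ψ₀` (`PeriodicGroundStateFeynmanKac_holds`), bounded between positive constants `m₀ ≤ Ψ₀ ≤ M`;
with `g = m₀/M` and `η = min(1/2, (g/8)²)`, `rigidity_of_nearMinimiser` gives `δ > 0` such that every
`δ`-near-minimiser is `η`-close to `αΨ₀` (`1-η ≤ |α|² ≤ 1`), and then `G_Ψ(i,r) ≥ g/4 > 0` by the
`L²`-stability of the coherence and the floor `G_{Ψ₀} ≥ g` (`re_coh_pos_of_close`).
[cite: ReedSimonIV1978, Thm XIII.44] -/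
theorem stub_coherencePos_bounded :
    ∀ v : ℝ → ℝ≥0∞, IsRepulsiveFiniteRange v → (∃ C : ℝ≥0, ∀ r, v r ≤ C) →
      ∃ ρ₀ : ℝ, 0 < ρ₀ ∧ ∀ ρ : ℝ, 0 < ρ → ρ < ρ₀ → ∀ᶠ N : ℕ in atTop, ∃ δ : ℝ≥0∞, 0 < δ ∧
        ∀ Ψ : PeriodicTrialState N (sideLength ρ N),
          periodicEnergy v Ψ ≤ periodicGroundStateEnergy v N (sideLength ρ N) + δ → ∀ i : Fin N,
            ∀ r, 0 < (∫ X in cellN N (sideLength ρ N),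
              conj (Ψ.ψ (Function.update X i (X i + r))) * Ψ.ψ X).re := by
  intro v hv hbdd
  refine ⟨1, one_pos, fun ρ hρ _ => ?_⟩
  obtain ⟨C, hC⟩ := hbdd
  obtain ⟨R₀, hR₀⟩ := hv.2
  filter_upwards [(tendsto_sideLength_atTop hρ).eventually_gt_atTop (2 * R₀),
    eventually_ge_atTop 1] with N h2R hN
  set L := sideLength ρ N with hLdef
  have hL : 0 < L := Real.rpow_pos_of_pos (div_pos (Nat.cast_pos.2 hN) hρ) _
  -- bounded periodised potential (nearest image)
  have hb : ∀ x, periodizedPotential v L x ≤ C := fun x => by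
    obtain ⟨n₀, h⟩ := exists_periodizedPotential_eq_single hR₀ h2R hL x
    rw [h]; exact hC _
  -- the torus Feynman–Kac ground state
  obtain ⟨hGS, hcont, hpos⟩ :=
    PeriodicGroundStateFeynmanKac_holds.periodicFKGroundState (N := N) hN hL hv.1 ⟨C, hb⟩
  set Ψ₀ := periodicFKGroundState v N L with hΨ₀def
  obtain ⟨m₀, M, hm₀, hmM, hlo, hhi⟩ :=
    exists_pos_bounds_of_continuous_periodic_pos hL hcont hpos hGS.periodic
  have hnorm : ∫ X in cellN N L, Ψ₀ X ^ 2 = 1 :=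
    setIntegral_sq_eq_one_of_lintegral L hcont hGS.nonneg hGS.norm_eq
  set g : ℝ := m₀ / M with hg
  have hg0 : 0 < g := div_pos hm₀ (hm₀.trans_le hmM)
  -- the closeness parameter
  set η : ℝ := min (1 / 2) ((g / 8) ^ 2) with hηdef
  have hη : 0 < η := lt_min (by norm_num) (by positivity)
  have hη2 : η ≤ 1 / 2 := min_le_left _ _
  have hηg : Real.sqrt η ≤ g / 8 := by
    calc Real.sqrt η ≤ Real.sqrt ((g / 8) ^ 2) := Real.sqrt_le_sqrt (min_le_right _ _)
      _ = g / 8 := Real.sqrt_sq (by positivity)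
  -- rigidity of near-minimisers
  obtain ⟨δ, hδ, hrig⟩ := CorrectorClosure.HealingScaleKacInsertion.rigidity_of_nearMinimiser
    hv.1 hL hb hGS hcont hpos hη
  refine ⟨ENNReal.ofReal δ, ENNReal.ofReal_pos.2 hδ, fun Ψ hΨ i r => ?_⟩
  obtain ⟨α, hα1, hα2, hclose⟩ := hrig Ψ hΨ
  have hac : Continuous Ψ.ψ := Ψ.contDiff.continuous
  have hdc : Continuous fun X => Ψ.ψ X - α * (Ψ₀ X : ℂ) :=
    hac.sub (continuous_const.mul (Complex.continuous_ofReal.comp hcont))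
  have hclose' : ∫ X in cellN N L, ‖Ψ.ψ X - α * (Ψ₀ X : ℂ)‖ ^ 2 ≤ η :=
    setIntegral_norm_sub_sq_le_of_lintegral L hdc hη.le hclose
  have hanorm : ∫ X in cellN N L, ‖Ψ.ψ X‖ ^ 2 = 1 := by
    have h := Ψ.norm_eq
    rw [lintegral_cellN_nnnorm_sq_eq_ofReal L hac] at h
    have h0 : 0 ≤ ∫ X in cellN N L, ‖Ψ.ψ X‖ ^ 2 := integral_nonneg fun X => by positivity
    have := congrArg ENNReal.toReal h
    rwa [ENNReal.toReal_ofReal h0, ENNReal.toReal_one] at this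
  have key := re_coh_pos_of_close hL hcont hGS.periodic hm₀ hmM hlo hhi hnorm hac Ψ.periodic hanorm
    hη2 hηg hα1 hα2 hclose' (Pi.single i r)
  simp_rw [update_eq_add_single]
  exact lt_of_lt_of_le (by positivity) key

end Summit.AtomisticToContinuum.BoseEinsteinCondensation.Theorems

end
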